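import Mathlib
import Summits.Ventures.LatticeQCDFlow.TrivializingMaps.FisherRadiusCap
import Summits.Ventures.LatticeQCDFlow.TrivializingMaps.WilsonPinching
import Summits.Ventures.LatticeQCDFlow.TrivializingMaps.WilsonMeasureTrivializingMap
import HarnessLib

/-!
# A bulk transition caps every volume-uniform radius of Lüscher's trivializing flow (COROLLARY N, docked)

HONEST FRAMING: exact (Metropolis-corrected) sampling algorithms for lattice gauge theory; figures of
merit are autocorrelation/cost numbers at stated couplings and volumes; no continuum-physics claim.

THEORY-1 §13.4 COROLLARY N, end to end on the venture's own objects.  Three tree theorems are composed: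

* `WilsonPinching.wilson_fisherZeros_pinch` (Wave 0 side): if the free energy per plaquette of the
  Wilson theory `log Z_{Λ_k,β} / #plaquettes → p(β)` for real `β` near `β_c` and `p` is NOT real-analytic
  at `β_c`, then for every `r > 0` and all large `k` the complexified partition function
  `∫ e^{-s S_W} D[U]` of volume `L_k` has a zero in `B(β_c, r)`;
* `StrongCoupling.ambWilsonAction_coeConfig` (the dictionary, lean-2): Lüscher's ambient Wilson action
  read on the field manifold IS Wave 0's Wilson action in the defining representation,
  `ambWilsonAction (ιU) = wilsonAction ρ₀ U`;
* `wilson_radius_le_norm_of_zeros_accumulate` (THEOREM F′, Lüscher side): zeros of the finite-volume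
  partition functions `Z_L(s) = ∫ D[U] e^{-s S_W(ιU)}` accumulating at `s_c` cap every radius `ρ` of a
  THEOREM-A-type geometric gradient bound: `ρ ≤ |s_c|`.

## Results (namespace `Summit.Ventures.LatticeQCDFlow.TrivializingMaps`)

* `wilson_actionZ_eq_wilsonZ` — the two complexified partition functions are the same function of `s`;
* `wilson_zeros_accumulate_of_bulkTransition` — under the hypotheses of `wilson_fisherZeros_pinch` for
  `G = SU(n)`, `ρ₀` the defining representation, the zeros of `(Z_L)_L` accumulate at `β_c` in exactly
  the form THEOREM F′ consumes;
* **`wilson_radius_le_of_bulkTransition`** — hence every `(ρ, C)` satisfying THEOREM A's volume-uniform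
  geometric gradient bound for the Lüscher series of `S_W` has `ρ ≤ |β_c|`;
* `no_gradientBound_beyond_bulkTransition` — equivalently, NO THEOREM-A-type bound has a radius
  `ρ > |β_c|`: a bulk (first-order or continuous) transition of the `SU(n)` Wilson theory at `β_c`
  (in the units `s = β/N` of `Z_L`) is an absolute ceiling for the volume-uniform convergence radius of
  the trivializing-flow gradient series — "no volume-uniform trivializing flow continues through a bulk
  transition", now one Lean implication from the thermodynamic hypotheses to the cap.

What is NOT claimed: that the 4-dimensional `SU(2)`/`SU(3)` Wilson theory HAS a bulk transition (the
known strong-to-weak-coupling crossover is not asserted to be one); that the free energy converges (the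
hypothesis `hp` is consumed whole); any value of `β_c`.  The theorem is the implication.

[cite: Luscher2010Trivializing, §4.5(b)] for the question; the Fisher-zero mechanism is classical
(Fisher 1965; Friedli–Velenik 2017 Ch. 3 for the pressure/zeros dictionary); the composition is ours.
-/

open MeasureTheory ProbabilityTheory Filter Topology Complex Set Metric
open Literature.MathematicalPhysics.QuantumFieldTheory
open Literature.MathematicalPhysics.QuantumFieldTheory.Luscher2010
open Literature.MathematicalPhysics.QuantumFieldTheory.WilsonFlow (coeConfig)
open scoped Matrix Matrix.Norms.Frobenius ContDiff

namespace Summit.Ventures.LatticeQCDFlow.TrivializingMaps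

variable {d n : ℕ}

/-- **Dictionary for the partition functions.** Lüscher's `Z_L(s) = ∫ D[U] e^{-s S_W(ιU)}` (the
`complexMGF` of `-ambWilsonAction ∘ ι` under the product Haar measure) is Wave 0's complexified Wilson
partition function `∫ e^{-s S_W(U)} D[U]` in the defining representation. [ours; via
`StrongCoupling.ambWilsonAction_coeConfig`] -/
theorem wilson_actionZ_eq_wilsonZ (L : ℕ) [NeZero L] (s : ℂ) :
    complexMGF (fun U => -ambWilsonAction (coeConfig U))
        (trivialMeasure (Matrix.specialUnitaryGroup (Fin n) ℂ) d L) s =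
      ∫ U, cexp (-(s * (wilsonAction (StrongCoupling.defRep n) U : ℂ)))
        ∂(trivialMeasure (Matrix.specialUnitaryGroup (Fin n) ℂ) d L) := by
  simp only [complexMGF, StrongCoupling.ambWilsonAction_coeConfig, Complex.ofReal_neg, mul_neg]

/-- **Zeros accumulate at a bulk transition** (Wave 0 ⟶ Lüscher side).  Under the hypotheses of
`WilsonPinching.wilson_fisherZeros_pinch` for `G = SU(n)` and the defining representation — free energy
per plaquette converging to `p` for real `|β - β_c| < R` along the volumes `L_k`, `p` not analytic at
`β_c` — for every `r > 0` some volume `L` carries a zero `s₀` of `Z_L` with `|s₀ - β_c| < r`. -/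
theorem wilson_zeros_accumulate_of_bulkTransition (hd : 2 ≤ d) (L : ℕ → ℕ) [∀ k, NeZero (L k)]
    {βc R : ℝ} {p : ℝ → ℝ} (hR : 0 < R)
    (hp : ∀ β : ℝ, |β - βc| < R → Tendsto (fun k =>
      Real.log (partitionFunction (d := d) (L := L k) (StrongCoupling.defRep n) β).toReal /
        (Fintype.card (Plaquette d (L k)) : ℝ)) atTop (𝓝 (p β)))
    (hna : ¬ AnalyticAt ℝ p βc) :
    ∀ r > 0, ∃ (L' : ℕ) (_ : NeZero L') (s₀ : ℂ), ‖s₀ - βc‖ < r ∧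
      complexMGF (fun U => -ambWilsonAction (coeConfig U))
        (trivialMeasure (Matrix.specialUnitaryGroup (Fin n) ℂ) d L') s₀ = 0 := by
  intro r hr
  have h := WilsonPinching.wilson_fisherZeros_pinch (G := Matrix.specialUnitaryGroup (Fin n) ℂ)
    (StrongCoupling.defRep n) L continuous_subtype_val hd hR hp hna hr
  obtain ⟨k, s, hs, hZ⟩ := h.exists
  refine ⟨L k, inferInstance, s, ?_, ?_⟩
  · simpa [dist_eq_norm] using hs
  · rwa [wilson_actionZ_eq_wilsonZ]

/-- **COROLLARY N (docked): a bulk transition at `β_c` caps every volume-uniform gradient radius by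
`|β_c|`.**  If the free energy per plaquette of the `SU(n)` Wilson theory (defining representation,
weight `e^{-β S_W}`, `S_W = ∑_p Re tr(1 - U_p)`) converges for real `β` near `β_c` along some volumes and
its limit is not real-analytic at `β_c`, then every pair `(ρ, C)` satisfying THEOREM A's volume-uniform
geometric gradient bound `|∂^a_e S̃^{(k)}(ιU)| ≤ C ρ^{-k}` for the Lüscher series of `S_W` (all volumes,
all bases, all smooth solutions) obeys `ρ ≤ |β_c|`. [cite: Luscher2010Trivializing, §4.5(b)] -/
theorem wilson_radius_le_of_bulkTransition (hd : 2 ≤ d) (L : ℕ → ℕ) [∀ k, NeZero (L k)]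
    {βc R : ℝ} {p : ℝ → ℝ} (hR : 0 < R)
    (hp : ∀ β : ℝ, |β - βc| < R → Tendsto (fun k =>
      Real.log (partitionFunction (d := d) (L := L k) (StrongCoupling.defRep n) β).toReal /
        (Fintype.card (Plaquette d (L k)) : ℝ)) atTop (𝓝 (p β)))
    (hna : ¬ AnalyticAt ℝ p βc) {ρ C : ℝ} (hρ : 0 < ρ)
    (hA : ∀ (L : ℕ) [NeZero L] (B : SuBasis n) (Sk : ℕ → AmbConfig d L n → ℝ) (c : ℕ → ℝ),
      (∀ k, ContDiff ℝ ∞ (Sk k)) → IsLuscherSeries B ambWilsonAction Sk c →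
      ∀ (k : ℕ) (U : GaugeConfig d L (Matrix.specialUnitaryGroup (Fin n) ℂ)) (e : Edge d L)
        (a : B.ι), |linkDeriv e (B.T a) (Sk k) (coeConfig U)| ≤ C * ρ⁻¹ ^ k)
    (B : SuBasis n) : ρ ≤ |βc| := by
  have h := wilson_radius_le_norm_of_zeros_accumulate hρ hA B
    (wilson_zeros_accumulate_of_bulkTransition hd L hR hp hna)
  simpa using h

/-- **No THEOREM-A-type bound reaches past a bulk transition.**  Under the same thermodynamic
hypotheses, for every `ρ > |β_c|` there is NO constant `C` making `|∂^a_e S̃^{(k)}(ιU)| ≤ C ρ^{-k}` hold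
for all volumes, bases, smooth Lüscher series of `S_W`, orders, configurations, links and colours —
the volume-uniform radius of convergence of the trivializing-flow gradient series cannot exceed the
transition coupling. [cite: Luscher2010Trivializing, §4.5(b)] -/
theorem no_gradientBound_beyond_bulkTransition (hd : 2 ≤ d) (L : ℕ → ℕ) [∀ k, NeZero (L k)]
    {βc R : ℝ} {p : ℝ → ℝ} (hR : 0 < R)
    (hp : ∀ β : ℝ, |β - βc| < R → Tendsto (fun k =>
      Real.log (partitionFunction (d := d) (L := L k) (StrongCoupling.defRep n) β).toReal /
        (Fintype.card (Plaquette d (L k)) : ℝ)) atTop (𝓝 (p β)))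
    (hna : ¬ AnalyticAt ℝ p βc) (B : SuBasis n) {ρ : ℝ} (hρ : |βc| < ρ) :
    ¬ ∃ C : ℝ, ∀ (L : ℕ) [NeZero L] (B : SuBasis n) (Sk : ℕ → AmbConfig d L n → ℝ) (c : ℕ → ℝ),
      (∀ k, ContDiff ℝ ∞ (Sk k)) → IsLuscherSeries B ambWilsonAction Sk c →
      ∀ (k : ℕ) (U : GaugeConfig d L (Matrix.specialUnitaryGroup (Fin n) ℂ)) (e : Edge d L)
        (a : B.ι), |linkDeriv e (B.T a) (Sk k) (coeConfig U)| ≤ C * ρ⁻¹ ^ k := by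
  rintro ⟨C, hA⟩
  have hρ0 : 0 < ρ := lt_of_le_of_lt (abs_nonneg βc) hρ
  exact absurd (wilson_radius_le_of_bulkTransition hd L hR hp hna hρ0 hA B) (not_le.mpr hρ)

end Summit.Ventures.LatticeQCDFlow.TrivializingMaps
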